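import Mathlib
import Literature.Computability.AlgebraicComplexity.PrattTrapezoidVal

/-!
# Linked parallel lines and the triangle rule for equilateral trapezoid-free triples

Support file for route `MatrixMultiplication/EisensteinValCertificates`, crux
`stmt-MatrixMultiplication-7788` (`PrimeValSaving`, the `3/2 − δ` rung) and its XL sibling
`PrimeFourThirdsSaving` (stmt-7790): the three systems of Pratt's Def. 3.2
(`Literature.Computability.AlgebraicComplexity.IsEquilateralTrapezoidFree`, additive notation
`a + b + c = 0`) unfolded into the incidence statements a structure proof works with.  Call
`(a,b,c) ∈ A×B×C` with `a+b+c = 0` a *point*; it lies on the `A`-line `a`, the `B`-line `b` and the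
`C`-line `c`.

* `c_eq_of_two_common` (system 1, fixed `a' ∈ A`, `b' ∈ B`): two `C`-lines each meeting both the
  `A`-line `a'` and the `B`-line `b'` coincide.
* `b_eq_of_two_common` (system 2, fixed `a'`, `c'`): two `B`-lines each meeting both `a'` and `c'`
  coincide — equivalently, two `B`-lines linked by a common `A`-line have DISJOINT `C`-line sets.
* `a_eq_of_two_common` (system 3, fixed `b'`, `c'`): two `A`-lines each meeting both `b'` and `c'`
  coincide.
* `not_mem_of_two_points` — the **triangle rule** (Pratt's triforce, Def. 4.10, as a consequence):
  if the `A`-line `a` carries two points with `B`-coordinates `b` and `b + d`, `d ≠ 0`, then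
  `a + d ∉ A`.

All statements hold in every additive group (no commutativity needed except in the triangle rule,
which is stated for abelian groups). [cite: Pratt2024, Def. 3.2, Def. 4.10]
-/

-- single-conjunct summit: the mandated namespace repeats `MatrixMultiplication`.
set_option linter.dupNamespace false

namespace Summit.MatrixMultiplication.MatrixMultiplication.Theorems

namespace PrattValLinkedLines

open Finset Literature.Computability.AlgebraicComplexity

section General

variable {G : Type*} [AddGroup G] [DecidableEq G] {A B C : Finset G}

/-- **System 1 unfolded.** If `c₁, c₂ ∈ C` both meet the `A`-line `a'` (some `b ∈ B` with
`a' + b + cᵢ = 0`) and the `B`-line `b'` (some `a ∈ A` with `a + b' + cᵢ = 0`), then `c₁ = c₂`.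
[cite: Pratt2024, Def. 3.2 (first system)] -/
theorem c_eq_of_two_common (h : IsEquilateralTrapezoidFree A B C) {a' b' a₁ a₂ b₁ b₂ c₁ c₂ : G}
    (ha' : a' ∈ A) (hb' : b' ∈ B) (ha₁ : a₁ ∈ A) (ha₂ : a₂ ∈ A) (hb₁ : b₁ ∈ B) (hb₂ : b₂ ∈ B)
    (hc₁ : c₁ ∈ C) (hc₂ : c₂ ∈ C)
    (e₁ : a' + b₁ + c₁ = 0) (f₁ : a₁ + b' + c₁ = 0) (e₂ : a' + b₂ + c₂ = 0) (f₂ : a₂ + b' + c₂ = 0) :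
    c₁ = c₂ := by
  have key := Finset.card_le_one.1 (h.1 a' ha' b' hb') (a₁, b₁, c₁) ?_ (a₂, b₂, c₂) ?_
  · exact (Prod.ext_iff.1 (Prod.ext_iff.1 key).2).2
  · simp only [mem_filter, mem_product]
    exact ⟨⟨ha₁, hb₁, hc₁⟩, e₁, f₁⟩
  · simp only [mem_filter, mem_product]
    exact ⟨⟨ha₂, hb₂, hc₂⟩, e₂, f₂⟩

/-- **System 2 unfolded.** If `b₁, b₂ ∈ B` both meet the `A`-line `a'` (`a' + bᵢ + cᵢ = 0` with
`cᵢ ∈ C`) and the `C`-line `c'` (`aᵢ + bᵢ + c' = 0` with `aᵢ ∈ A`), then `b₁ = b₂`: two `B`-lines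
through a common `A`-line have disjoint `C`-line sets. [cite: Pratt2024, Def. 3.2 (second system)] -/
theorem b_eq_of_two_common (h : IsEquilateralTrapezoidFree A B C) {a' c' a₁ a₂ b₁ b₂ c₁ c₂ : G}
    (ha' : a' ∈ A) (hc' : c' ∈ C) (ha₁ : a₁ ∈ A) (ha₂ : a₂ ∈ A) (hb₁ : b₁ ∈ B) (hb₂ : b₂ ∈ B)
    (hc₁ : c₁ ∈ C) (hc₂ : c₂ ∈ C)
    (e₁ : a' + b₁ + c₁ = 0) (f₁ : a₁ + b₁ + c' = 0) (e₂ : a' + b₂ + c₂ = 0) (f₂ : a₂ + b₂ + c' = 0) :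
    b₁ = b₂ := by
  have key := Finset.card_le_one.1 (h.2.1 a' ha' c' hc') (a₁, b₁, c₁) ?_ (a₂, b₂, c₂) ?_
  · exact (Prod.ext_iff.1 (Prod.ext_iff.1 key).2).1
  · simp only [mem_filter, mem_product]
    exact ⟨⟨ha₁, hb₁, hc₁⟩, e₁, f₁⟩
  · simp only [mem_filter, mem_product]
    exact ⟨⟨ha₂, hb₂, hc₂⟩, e₂, f₂⟩

/-- **System 3 unfolded.** If `a₁, a₂ ∈ A` both meet the `B`-line `b'` (`aᵢ + b' + cᵢ = 0` with
`cᵢ ∈ C`) and the `C`-line `c'` (`aᵢ + bᵢ + c' = 0` with `bᵢ ∈ B`), then `a₁ = a₂`.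
[cite: Pratt2024, Def. 3.2 (third system)] -/
theorem a_eq_of_two_common (h : IsEquilateralTrapezoidFree A B C) {b' c' a₁ a₂ b₁ b₂ c₁ c₂ : G}
    (hb' : b' ∈ B) (hc' : c' ∈ C) (ha₁ : a₁ ∈ A) (ha₂ : a₂ ∈ A) (hb₁ : b₁ ∈ B) (hb₂ : b₂ ∈ B)
    (hc₁ : c₁ ∈ C) (hc₂ : c₂ ∈ C)
    (e₁ : a₁ + b' + c₁ = 0) (f₁ : a₁ + b₁ + c' = 0) (e₂ : a₂ + b' + c₂ = 0) (f₂ : a₂ + b₂ + c' = 0) :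
    a₁ = a₂ := by
  have key := Finset.card_le_one.1 (h.2.2 b' hb' c' hc') (a₁, b₁, c₁) ?_ (a₂, b₂, c₂) ?_
  · exact (Prod.ext_iff.1 key).1
  · simp only [mem_filter, mem_product]
    exact ⟨⟨ha₁, hb₁, hc₁⟩, e₁, f₁⟩
  · simp only [mem_filter, mem_product]
    exact ⟨⟨ha₂, hb₂, hc₂⟩, e₂, f₂⟩

end General

section Triangle

variable {G : Type*} [AddCommGroup G] [DecidableEq G] {A B C : Finset G}

/-- **Triangle rule** (the 3-point case of Def. 3.2 = Pratt's triforce, Def. 4.10): if the `A`-line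
`a` carries the two points `(a, b, c)` and `(a, b + d, c - d)` with `d ≠ 0`, then the parallel line
`a + d` is absent from `A` — otherwise `(a + d, b, c - d)` would be a third point and the `B`-line
`b` and the `C`-line `c - d` would have the two common `A`-lines `a`, `a + d`.
[cite: Pratt2024, Def. 3.2 and Def. 4.10] -/
theorem not_mem_of_two_points (h : IsEquilateralTrapezoidFree A B C) {a b c d : G}
    (ha : a ∈ A) (hb : b ∈ B) (hbd : b + d ∈ B) (hc : c ∈ C) (hcd : c - d ∈ C)
    (e : a + b + c = 0) (hd : d ≠ 0) : a + d ∉ A := by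
  intro had
  have e₂ : (a + d) + b + (c - d) = 0 := by rw [← e]; abel
  have f₂ : (a + d) + b + (c - d) = 0 := e₂
  -- columns `a` and `a + d` both meet the `B`-line `b` and the `C`-line `c - d`
  have key := a_eq_of_two_common h (b' := b) (c' := c - d) hb hcd ha had hbd hb hc hcd
    e (by rw [← e]; abel) e₂ f₂
  exact hd (by simpa using key)

/-- The triangle rule in the other orientation: under the same hypotheses `a - d ∉ A` as well, unless
`d = 0` — otherwise `(a - d, b + d, c)` would be a point and the `B`-line `b + d` and the `C`-line
`c` would have the two common `A`-lines `a`, `a - d`. [cite: Pratt2024, Def. 3.2 and Def. 4.10] -/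
theorem not_mem_of_two_points' (h : IsEquilateralTrapezoidFree A B C) {a b c d : G}
    (ha : a ∈ A) (hb : b ∈ B) (hbd : b + d ∈ B) (hc : c ∈ C) (hcd : c - d ∈ C)
    (e : a + b + c = 0) (hd : d ≠ 0) : a - d ∉ A := by
  intro had
  have e₂ : (a - d) + (b + d) + c = 0 := by rw [← e]; abel
  have key := a_eq_of_two_common h (b' := b + d) (c' := c) hbd hc ha had hb hbd hcd hc
    (by rw [← e]; abel) e e₂ e₂
  exact hd (by simpa [sub_eq_self] using key.symm)

end Triangle

end PrattValLinkedLines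

end Summit.MatrixMultiplication.MatrixMultiplication.Theorems
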